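import Literature.NumberTheory.EllipticCurves.ModularPolynomialDiagonal
import HarnessLib

/-!
# The modular equation of prime level is symmetric: `Φ_p(X, Y) = Φ_p(Y, X)` (Cox, Thm. 11.18 (iii))

certified instances and evidence bearing on the general Hodge conjecture; no claim.

Topic `NumberTheory/EllipticCurves` (complex multiplication).  Theorem-only file (no definition, no named
fact).  PRINTED (the statement): for EVERY prime `p`, the tree's modular equation — `modularPolynomial p ∈ ℂ[Y][X]`
(`ModularPolynomial.lean`: `Φ_p(X, j(τ)) = ∏_{σ ∈ C(p)} (X − j(στ))`, Cox, *Primes of the form x² + ny²*,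
2nd ed., §11.B (11.14)–(11.15)) and its integer model `intModularPolynomial p ∈ ℤ[Y][X]`
(`ModularPolynomialIntegral.lean`, Cox Thm. 11.18 (i)) — satisfies
`((intModularPolynomial p).coeff m).coeff n = ((intModularPolynomial p).coeff n).coeff m` for all `m, n`,
i.e. **`Φ_p(X, Y) = Φ_p(Y, X)`** (Cox Thm. 11.18 (iii): "`Φ_m(X, Y) = Φ_m(Y, X)` if `m > 1`"), with the pointwise
form `Φ_p(x, y) = Φ_p(y, x)` and the consequence `deg_Y Φ_p = p + 1` exactly (the `Y^{p+1}`-coefficient of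
`P₀` is `1`, the consequence of (iii) that `ModularPolynomialDegY.lean` left at `≤`; cf. Cox (13.15)).  The tree had
(iii) only at `p = 3` (`intModularPolynomial_three_coeff_symm`, by five CM columns).

## METHOD (OURS): the classical proof (Lang Ch. 5 §2 Thm. 3, Cox's reference for (iii)), irreducibility → a generic fibre

Classically `Φ_m(j(τ), j(mτ)) = 0` (as `τ = σ(mτ)`, `σ = (1 0; 0 m)`), so `Φ_m(j(τ), Y)` vanishes at a root of the
IRREDUCIBLE `Φ_m(Y, j(τ))`, whence `Φ_m(Y, X) = ±Φ_m(X, Y)`, and `−` would force `Φ_m(X, X) = 0`.  Here instead: (1) at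
`τ = 1/8 + iy`, `y > p`, the points `pτ`, `(τ + k)/p` have imaginary parts `py ≠ y/p > 1` and real parts `p/8`,
`(1 + 8k)/(8p) ∉ ½ + ℤ`, pairwise incongruent mod `1`, so their integer translates are `p + 1` DIFFERENT points
of the open fundamental domain `𝒟ᵒ`, and by Cox Thm. 11.2 (`kleinJ_eq_kleinJ_iff`) with Mathlib's
`ModularGroup.eq_smul_self_of_mem_fdo_mem_fdo` the conjugates `j(στ)` are pairwise distinct
(`ModularPolynomialSymm.jConj_injective`); (2) there, `X ↦ Φ_p(j(τ), X) − κ₀ Φ_p(X, j(τ))` (`κ₀ :=` the `Y^{p+1}`-coefficient of `P₀`)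
has degree `≤ p` (`deg_Y P_m ≤ p` for `m ≥ 1`, `P_{p+1} = 1`) and the `p + 1` distinct roots `j(στ)` (fibre
identity + reversed relations `Φ_p(j(τ), j(στ)) = 0`), so `Φ_p(j(τ), x) = κ₀ Φ_p(x, j(τ))`; (3) for fixed `x`,
`Y ↦ Φ_p(Y, x) − κ₀ Φ_p(x, Y)` then vanishes at the infinitely many distinct values `j(1/8 + iy)`, so
`κ_{n,m} = κ₀ κ_{m,n}`, and `κ_{p,p} = −1` (Cox (13.15); tree `coeff_modularPolynomialCoeff_self`) gives `κ₀ = 1`.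

Main statements: `ModularPolynomialSymm.jConj_injective`; `modularPolynomialCoeff_coeff_symm`, `intModularPolynomial_coeff_symm`;
`modularPolynomial_eval_symm`, `intModularPolynomial_eval_symm`; `coeff_modularPolynomialCoeff_zero_succ`, `natDegree_…_zero`.

## References

* [Cox2013] D. A. Cox, *Primes of the form x² + ny²*, 2nd ed., Wiley 2013: §11.C Thm. 11.18 (iii) (PDF p. 240:
  "(iii) `Φ_m(X,Y) = Φ_m(Y,X)` if `m > 1`"; p. 241: "a proof of (iii) may be found in Lang [73, §5.2, Theorem 3]"),
  §13.B (13.15) (the symmetric shape of `Φ_p`, p. 295) and proof of Prop. 13.17 (`τ = pu − i`), §11.A–B Thm. 11.2,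
  (11.12)–(11.15).  [Lang1987] S. Lang, *Elliptic Functions*, 2nd ed., GTM 112 (1987), Ch. 5 §2 Thm. 3 (ii)
  "`Φ_n(X, j) = Φ_n(j, X)`" and its proof (PDF pp. 39–40: irreducibility over `ℂ(j)` + Gauss lemma; the classical proof).
-/

noncomputable section

open Complex Polynomial
open UpperHalfPlane hiding I
open scoped MatrixGroups Modular

namespace Literature.NumberTheory.EllipticCurves

open ModularForms

variable {p : ℕ} [Fact p.Prime]

namespace ModularPolynomialSymm
/-- Two points of the open fundamental domain `𝒟ᵒ` with the same `j`-invariant are equal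
(Cox Thm. 11.2: `j(τ) = j(τ') ↔ τ' ∈ SL₂(ℤ)τ`, plus Mathlib's uniqueness in `𝒟ᵒ`). [cite: Cox2013, §11.A Thm. 11.2] -/
theorem eq_of_mem_fdo_of_kleinJ_eq {z₁ z₂ : ℍ} (h₁ : z₁ ∈ 𝒟ᵒ) (h₂ : z₂ ∈ 𝒟ᵒ) (hj : kleinJ z₁ = kleinJ z₂) :
    z₁ = z₂ := by
  obtain ⟨γ, hγ⟩ := kleinJ_eq_kleinJ_iff.mp hj
  rw [← hγ] at h₂ ⊢
  exact ModularGroup.eq_smul_self_of_mem_fdo_mem_fdo h₁ h₂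

/-- A point with `Im > 1` whose real part is not a half-integer has an integer translate in `𝒟ᵒ`. [folklore] -/
private theorem exists_T_zpow_smul_mem_fdo {z : ℍ} (him : 1 < z.im) (hre : ∀ m : ℤ, z.re ≠ m + 1 / 2) :
    ∃ n : ℤ, ModularGroup.T ^ n • z ∈ 𝒟ᵒ := by
  refine ⟨-round z.re, ?_, ?_⟩
  · rw [Complex.normSq_apply, UpperHalfPlane.coe_re, UpperHalfPlane.coe_im, ModularGroup.im_T_zpow_smul]
    nlinarith [mul_self_nonneg (ModularGroup.T ^ (-round z.re) • z).re]
  · have h2 : |z.re - round z.re| ≠ 1 / 2 := fun h ↦ by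
      rcases (abs_eq (by norm_num : (0 : ℝ) ≤ 1 / 2)).mp h with h' | h'
      · exact hre (round z.re) (by linarith)
      · exact hre (round z.re - 1) (by push_cast; linarith)
    rw [ModularGroup.re_T_zpow_smul, Int.cast_neg, ← sub_eq_add_neg]
    exact lt_of_le_of_ne (abs_sub_round z.re) h2

/-- Points `τ` with `Re τ = 1/8`, `Im τ > 1` lie in `𝒟ᵒ`. [folklore] -/
private theorem mem_fdo_of_re_eq {τ : ℍ} (hre : τ.re = 1 / 8) (him : 1 < τ.im) : τ ∈ 𝒟ᵒ := by
  refine ⟨?_, ?_⟩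
  · rw [Complex.normSq_apply, UpperHalfPlane.coe_re, UpperHalfPlane.coe_im, hre]
    nlinarith
  · rw [hre]; norm_num

/-- Such points exist: `τ = 1/8 + iy ∈ ℍ` for every `y > 0`. [folklore] -/
private theorem exists_point (y : ℝ) (hy : 0 < y) : ∃ τ : ℍ, τ.re = 1 / 8 ∧ τ.im = y :=
  ⟨UpperHalfPlane.mk ⟨1 / 8, y⟩ hy, rfl, rfl⟩

/-! ### §2 A generic fibre: at `τ = 1/8 + iy`, `y > p`, the `p + 1` conjugates `j(στ)` are pairwise distinct -/

/-- `p/8` is not a half-integer (`p ≠ 8m + 4` for a prime `p`). [folklore] -/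
private theorem re_mulPoint_ne (m : ℤ) : (p : ℝ) * (1 / 8) ≠ m + 1 / 2 := by
  intro h
  have hz : (p : ℤ) = 8 * m + 4 := by
    exact_mod_cast (by push_cast; linarith : ((p : ℤ) : ℝ) = ((8 * m + 4 : ℤ) : ℝ))
  have h2 : (2 : ℕ) ∣ p := Int.natCast_dvd_natCast.mp ⟨4 * m + 2, by rw [hz]; ring⟩
  have hp2 : p = 2 := (((Fact.out : p.Prime).eq_one_or_self_of_dvd 2 h2).resolve_left (by norm_num)).symm
  subst hp2
  omega

/-- `(1/8 + k)/p` is not a half-integer (`1 + 8k` is odd, `8pm + 4p` is even). [folklore] -/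
private theorem re_divPoint_ne (k m : ℤ) : (1 / 8 + k) / (p : ℝ) ≠ m + 1 / 2 := by
  intro h
  have hp : (0 : ℝ) < p := modularLevel_pos
  rw [div_eq_iff hp.ne'] at h
  have hz : (1 + 8 * k : ℤ) = 8 * p * m + 4 * p := by
    exact_mod_cast (by push_cast; linarith : ((1 + 8 * k : ℤ) : ℝ) = ((8 * p * m + 4 * p : ℤ) : ℝ))
  have h2 : (2 : ℤ) ∣ 1 + 8 * k := by rw [hz]; exact ⟨4 * p * m + 2 * p, by ring⟩
  omega

/-- **Distinct conjugates at a generic point.** For `τ = 1/8 + iy`, `y > p`, the `p + 1` numbers `j(pτ)`,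
`j((τ + k)/p)` (`0 ≤ k < p`) are pairwise distinct: integer translates of the `p + 1` points lie in `𝒟ᵒ` with
pairwise different (real part, imaginary part). [cite: Cox2013, §11.A Thm. 11.2 and §11.B (11.12)–(11.15)] -/
theorem jConj_injective {τ : ℍ} (hre : τ.re = 1 / 8) (him : (p : ℝ) < τ.im) :
    Function.Injective fun i : Option (ZMod p) ↦ jConj i τ := by
  have hp1 : (1 : ℝ) < p := by exact_mod_cast (Fact.out : p.Prime).one_lt
  have hp0 : (0 : ℝ) < p := modularLevel_pos
  have h3 : τ.im < p * τ.im := by nlinarith [τ.im_pos]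
  have h4 : p * τ.im < p * τ.im * p := by nlinarith [τ.im_pos]
  have hreI : (mulPoint p τ).re = p * (1 / 8) := by
    rw [← UpperHalfPlane.coe_re, coe_mulPoint, Complex.mul_re, UpperHalfPlane.coe_re, UpperHalfPlane.coe_im, hre]
    simp
  have hrek : ∀ k : ℤ, (divPoint p k τ).re = (1 / 8 + k) / p := fun k ↦ by
    rw [← UpperHalfPlane.coe_re, coe_divPoint, Complex.div_natCast_re, Complex.add_re, UpperHalfPlane.coe_re,
      hre, Complex.intCast_re]
  obtain ⟨nI, hnI⟩ := exists_T_zpow_smul_mem_fdo (z := mulPoint p τ) (by rw [im_mulPoint]; linarith)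
    (fun m ↦ by rw [hreI]; exact re_mulPoint_ne m)
  have hk : ∀ k : ℤ, ∃ n : ℤ, ModularGroup.T ^ n • divPoint p k τ ∈ 𝒟ᵒ := fun k ↦
    exists_T_zpow_smul_mem_fdo (by rw [im_divPoint, lt_div_iff₀ hp0]; linarith)
      (fun m ↦ by rw [hrek]; exact re_divPoint_ne k m)
  choose n hn using hk
  have hjI : jConj (p := p) none τ = kleinJ (ModularGroup.T ^ nI • mulPoint p τ) := by rw [jConj_none, kleinJ_smul]
  have hjk : ∀ k : ZMod p, jConj (some k) τ =
      kleinJ (ModularGroup.T ^ n k.val • divPoint p (k.val : ℤ) τ) := fun k ↦ by rw [jConj_some, kleinJ_smul]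
  -- `j(pτ) ≠ j((τ + k)/p)`: the imaginary parts `p·y ≠ y/p` of the translates differ
  have hIk : ∀ k : ZMod p, jConj (p := p) none τ ≠ jConj (some k) τ := fun k h ↦ by
    rw [hjI, hjk] at h
    have heq := congr_arg UpperHalfPlane.im (eq_of_mem_fdo_of_kleinJ_eq hnI (hn _) h)
    rw [ModularGroup.im_T_zpow_smul, ModularGroup.im_T_zpow_smul, im_mulPoint, im_divPoint, eq_div_iff hp0.ne'] at heq
    linarith
  intro i i' h
  rcases i with _ | k <;> rcases i' with _ | k'
  · rfl
  · exact absurd h (hIk k')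
  · exact absurd h.symm (hIk k)
  · -- `j((τ + k)/p) = j((τ + k')/p)` forces `(k − k')/p ∈ ℤ`
    simp only [hjk] at h
    have heq := congr_arg UpperHalfPlane.re (eq_of_mem_fdo_of_kleinJ_eq (hn _) (hn _) h)
    rw [ModularGroup.re_T_zpow_smul, ModularGroup.re_T_zpow_smul, hrek, hrek, div_add' _ _ _ hp0.ne',
      div_add' _ _ _ hp0.ne', div_left_inj' hp0.ne'] at heq
    have hz : (((k.val : ℤ) : ℝ)) - ((k'.val : ℤ) : ℝ) = (p : ℝ) * (((n k'.val - n k.val : ℤ)) : ℝ) := by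
      push_cast at heq ⊢
      linarith
    have hz' : (k.val : ℤ) - k'.val = p * (n k'.val - n k.val) := by exact_mod_cast hz
    have hmod : ((k.val : ℤ) : ZMod p) = ((k'.val : ℤ) : ZMod p) := by
      rw [← sub_eq_zero, ← Int.cast_sub, hz']
      simp
    simp only [Int.cast_natCast, ZMod.natCast_zmod_val] at hmod
    rw [hmod]

/-! ### §3 `Φ_p(x, y)` as a double sum; known coefficients; the fibre and the reversed relations -/

/-- `Φ_p(x, y) = Σ_{m ≤ p+1} (Σ_{n ≤ p+1} κ_{m,n} yⁿ) xᵐ`, `κ_{m,n} = ` the `Yⁿ`-coefficient of `P_m`.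
[cite: Cox2013, §11.B (11.14)] -/
theorem eval_eq_sum (x y : ℂ) : ((modularPolynomial p).map (evalRingHom y)).eval x =
    ∑ m ∈ Finset.range (p + 2), (∑ n ∈ Finset.range (p + 2),
      (modularPolynomialCoeff p m).coeff n * y ^ n) * x ^ m := by
  have hdeg : ((modularPolynomial p).map (evalRingHom y)).natDegree < p + 2 :=
    lt_of_le_of_lt (natDegree_map_le.trans natDegree_modularPolynomial.le) (by omega)
  rw [eval_eq_sum_range' hdeg]
  refine Finset.sum_congr rfl fun m _ ↦ ?_
  have hdeg' : (modularPolynomialCoeff p m).natDegree < p + 2 :=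
    lt_of_le_of_lt (natDegree_modularPolynomialCoeff_le_succ p m) (by omega)
  rw [coeff_map, coe_evalRingHom, coeff_modularPolynomial, eval_eq_sum_range' hdeg']

/-- The same double sum, summed the other way: `Φ_p(x, y) = Σ_n (Σ_m κ_{m,n} xᵐ) yⁿ`. [cite: Cox2013, §11.B (11.14)] -/
theorem eval_eq_sum_swap (x y : ℂ) : ((modularPolynomial p).map (evalRingHom y)).eval x =
    ∑ n ∈ Finset.range (p + 2), (∑ m ∈ Finset.range (p + 2),
      (modularPolynomialCoeff p m).coeff n * x ^ m) * y ^ n := by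
  rw [eval_eq_sum]
  simp_rw [Finset.sum_mul]
  rw [Finset.sum_comm]
  exact Finset.sum_congr rfl fun n _ ↦ Finset.sum_congr rfl fun m _ ↦ by ring

/-- `κ_{p+1,n} = [n = 0]` (`P_{p+1} = 1`: `Φ_p` is monic of degree `p + 1` in `X`). [cite: Cox2013, §11.B after (11.15)] -/
theorem coeff_succ_coeff (n : ℕ) : (modularPolynomialCoeff p (p + 1)).coeff n = if n = 0 then 1 else 0 := by
  rw [modularPolynomialCoeff_succ_p, coeff_one]

/-- `κ_{m,p+1} = 0` for `m ≥ 1` (`deg_Y P_m ≤ p`). [cite: Cox2013, §11.C Thm. 11.18(iii)] -/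
theorem coeff_coeff_succ_of_pos {m : ℕ} (hm : 1 ≤ m) : (modularPolynomialCoeff p m).coeff (p + 1) = 0 :=
  coeff_eq_zero_of_natDegree_lt (lt_of_le_of_lt (natDegree_modularPolynomialCoeff_le_of_pos p hm) (by omega))

/-- `Φ_p(j(στ), j(τ)) = 0` for every `σ ∈ C(p)`. [cite: Cox2013, §11.B after (11.15)] -/
theorem eval_jConj_kleinJ (i : Option (ZMod p)) (τ : ℍ) :
    ((modularPolynomial p).map (evalRingHom (kleinJ τ))).eval (jConj i τ) = 0 := by
  rw [map_kleinJ_modularPolynomial]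
  exact modularPolyAt_eval_jConj i τ

/-- **Reversed relations** `Φ_p(j(τ), j(στ)) = 0`: `τ = (pτ + 0)/p` and `p·((τ + k)/p) = τ + k` (Cox: "`τ = pu − i`").
[cite: Cox2013, §11.B (11.15) and §13.B proof of Prop. 13.17] -/
theorem eval_kleinJ_jConj (i : Option (ZMod p)) (τ : ℍ) :
    ((modularPolynomial p).map (evalRingHom (jConj i τ))).eval (kleinJ τ) = 0 := by
  cases i with
  | none =>
    have e : divPoint p 0 (mulPoint p τ) = τ := by
      apply UpperHalfPlane.ext
      rw [coe_divPoint, coe_mulPoint, Int.cast_zero, add_zero, mul_div_cancel_left₀ _ modularLevel_ne_zero]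
    simpa only [e, jConj_none] using modularPolynomial_kleinJ_divPoint (p := p) 0 (mulPoint p τ)
  | some k =>
    have e : mulPoint p (divPoint p (k.val : ℤ) τ) = ModularGroup.T ^ (k.val : ℤ) • τ := by
      apply UpperHalfPlane.ext
      rw [coe_mulPoint, coe_divPoint, UpperHalfPlane.modular_T_zpow_smul, UpperHalfPlane.coe_vadd,
        ← mul_div_assoc, mul_div_cancel_left₀ _ modularLevel_ne_zero, add_comm]
      push_cast
      ring
    simpa only [e, kleinJ_smul, jConj_some] using modularPolynomial_kleinJ_mulPoint (p := p) (divPoint p (k.val : ℤ) τ)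

/-- If `Σ_{n<N} e n · yⁿ = 0` for all `y ∈ ℂ` then every `e n`, `n < N`, vanishes. [folklore] -/
private theorem coeff_eq_zero_of_forall_sum_eq_zero {N : ℕ} (e : ℕ → ℂ)
    (h : ∀ y : ℂ, ∑ n ∈ Finset.range N, e n * y ^ n = 0) : ∀ n < N, e n = 0 := by
  intro n hn
  set q : ℂ[X] := ∑ k ∈ Finset.range N, C (e k) * X ^ k with hq_def
  have hzero : q = 0 := Polynomial.funext fun y ↦ by simp [hq_def, eval_finsetSum, h y]
  have hc := congr_arg (fun r : ℂ[X] ↦ r.coeff n) hzero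
  simp only [hq_def, finsetSum_coeff, coeff_C_mul_X_pow, coeff_zero] at hc
  rw [Finset.sum_eq_single n (fun k _ hk ↦ if_neg (Ne.symm hk))
    (fun h' ↦ absurd (Finset.mem_range.mpr hn) h')] at hc
  simpa using hc

/-- At a point `τ` with pairwise distinct conjugates, `Φ_p(j(τ), x) = κ₀ Φ_p(x, j(τ))` for all `x` (`κ₀` = the
`Y^{p+1}`-coefficient of `P₀`): the difference has degree `≤ p` in `x` and the `p + 1` roots `j(στ)`.
[cite: Cox2013, §11.C Thm. 11.18(iii) and §11.B (11.15)] -/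
theorem eval_swap_eq_mul_of_injective {τ : ℍ} (hinj : Function.Injective fun i : Option (ZMod p) ↦ jConj i τ)
    (x : ℂ) : ((modularPolynomial p).map (evalRingHom x)).eval (kleinJ τ) =
      (modularPolynomialCoeff p 0).coeff (p + 1) * ((modularPolynomial p).map (evalRingHom (kleinJ τ))).eval x := by
  set κ₀ := (modularPolynomialCoeff p 0).coeff (p + 1) with hκ₀
  set c : ℕ → ℂ := fun n ↦ (∑ m ∈ Finset.range (p + 2), (modularPolynomialCoeff p m).coeff n * kleinJ τ ^ m) -
    κ₀ * (∑ n' ∈ Finset.range (p + 2), (modularPolynomialCoeff p n).coeff n' * kleinJ τ ^ n') with hc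
  have hdiff : ∀ x' : ℂ, ((modularPolynomial p).map (evalRingHom x')).eval (kleinJ τ) -
      κ₀ * ((modularPolynomial p).map (evalRingHom (kleinJ τ))).eval x' =
        ∑ n ∈ Finset.range (p + 2), c n * x' ^ n := by
    intro x'
    rw [eval_eq_sum_swap (kleinJ τ) x', eval_eq_sum x' (kleinJ τ), Finset.mul_sum, ← Finset.sum_sub_distrib]
    exact Finset.sum_congr rfl fun n _ ↦ by simp only [hc]; ring
  -- the top coefficient vanishes (`c (p+1) = κ₀ − κ₀·1`), so the difference has degree `≤ p`
  have htop : c (p + 1) = 0 := by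
    simp only [hc]
    rw [Finset.sum_eq_single 0 (fun m _ hm ↦ by
        rw [coeff_coeff_succ_of_pos (Nat.one_le_iff_ne_zero.mpr hm), zero_mul]) (by simp),
      Finset.sum_eq_single 0 (fun n' _ hn' ↦ by rw [coeff_succ_coeff, if_neg hn', zero_mul]) (by simp),
      coeff_succ_coeff, if_pos rfl, hκ₀]
    ring
  set d : ℂ[X] := ∑ n ∈ Finset.range (p + 1), C (c n) * X ^ n with hd_def
  have hd : ∀ x', d.eval x' = ((modularPolynomial p).map (evalRingHom x')).eval (kleinJ τ) -
      κ₀ * ((modularPolynomial p).map (evalRingHom (kleinJ τ))).eval x' := by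
    intro x'
    rw [hdiff, Finset.sum_range_succ, htop, zero_mul, add_zero]
    simp [hd_def, eval_finsetSum]
  have hdeg : d.natDegree < Fintype.card (Option (ZMod p)) := by
    rw [Fintype.card_option, ZMod.card]
    refine Nat.lt_succ_of_le (natDegree_sum_le_of_forall_le _ _ fun k hk ↦ ?_)
    exact (natDegree_C_mul_X_pow_le (c k) k).trans (Nat.le_of_lt_succ (Finset.mem_range.mp hk))
  have hzero : d = 0 := by
    refine eq_zero_of_natDegree_lt_card_of_eval_eq_zero d hinj (fun i ↦ ?_) hdeg
    show d.eval (jConj i τ) = 0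
    rw [hd, eval_kleinJ_jConj, eval_jConj_kleinJ, mul_zero, sub_zero]
  exact sub_eq_zero.mp (by simpa only [hzero, eval_zero] using (hd x).symm)

/-- **`Φ_p(y, x) = κ₀ · Φ_p(x, y)` for all `x, y ∈ ℂ`**: for fixed `x` the difference is a polynomial in `y`
vanishing at the infinitely many distinct values `j(1/8 + iy')`, `y' > p`. [cite: Cox2013, §11.C Thm. 11.18(iii)] -/
theorem eval_swap_eq_mul (x y : ℂ) : ((modularPolynomial p).map (evalRingHom x)).eval y =
    (modularPolynomialCoeff p 0).coeff (p + 1) * ((modularPolynomial p).map (evalRingHom y)).eval x := by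
  set κ₀ := (modularPolynomialCoeff p 0).coeff (p + 1) with hκ₀
  set e : ℕ → ℂ := fun m ↦ (∑ n ∈ Finset.range (p + 2), (modularPolynomialCoeff p m).coeff n * x ^ n) -
    κ₀ * (∑ m' ∈ Finset.range (p + 2), (modularPolynomialCoeff p m').coeff m * x ^ m') with he
  set q : ℂ[X] := ∑ m ∈ Finset.range (p + 2), C (e m) * X ^ m with hq_def
  have hq : ∀ y', q.eval y' = ((modularPolynomial p).map (evalRingHom x)).eval y' -
      κ₀ * ((modularPolynomial p).map (evalRingHom y')).eval x := by
    intro y'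
    rw [eval_eq_sum y' x, eval_eq_sum_swap x y', Finset.mul_sum, ← Finset.sum_sub_distrib]
    simp only [hq_def, eval_finsetSum, eval_mul, eval_C, eval_pow, eval_X]
    exact Finset.sum_congr rfl fun m _ ↦ by simp only [he]; ring
  -- infinitely many roots: `j` is injective on the generic points `1/8 + i(p + 1 + n)`, `n ∈ ℕ`
  have hpt : ∀ n : ℕ, ∃ τ : ℍ, τ.re = 1 / 8 ∧ τ.im = p + 1 + n := fun n ↦ exists_point _ (by positivity)
  choose t ht using hpt
  have hroot : ∀ n : ℕ, q.IsRoot (kleinJ (t n)) := fun n ↦ by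
    rw [IsRoot.def, hq, eval_swap_eq_mul_of_injective (jConj_injective (ht n).1 (by rw [(ht n).2]; linarith)),
      hκ₀, sub_self]
  have hinj : Function.Injective fun n : ℕ ↦ kleinJ (t n) := by
    intro n n' h
    have him : ∀ k : ℕ, 1 < (t k).im := fun k ↦ by
      rw [(ht k).2]; linarith [(Nat.cast_nonneg k : (0 : ℝ) ≤ k), (modularLevel_pos : (0 : ℝ) < p)]
    have heq := congr_arg UpperHalfPlane.im
      (eq_of_mem_fdo_of_kleinJ_eq (mem_fdo_of_re_eq (ht n).1 (him n)) (mem_fdo_of_re_eq (ht n').1 (him n')) h)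
    rw [(ht n).2, (ht n').2] at heq
    exact_mod_cast (add_left_cancel heq : (n : ℝ) = n')
  have hzero : q = 0 := eq_zero_of_infinite_isRoot q
    ((Set.infinite_range_of_injective hinj).mono (Set.range_subset_iff.mpr hroot))
  exact sub_eq_zero.mp (by simpa only [hzero, eval_zero] using (hq y).symm)

/-- **Coefficient identity** `κ_{n,m} = κ₀ · κ_{m,n}` for all `m, n`. [cite: Cox2013, §11.C Thm. 11.18(iii)] -/
theorem coeff_coeff_swap_eq_mul (m n : ℕ) : (modularPolynomialCoeff p n).coeff m =
    (modularPolynomialCoeff p 0).coeff (p + 1) * (modularPolynomialCoeff p m).coeff n := by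
  set κ₀ := (modularPolynomialCoeff p 0).coeff (p + 1) with hκ₀
  have hvan : ∀ (m' : ℕ) {n' : ℕ}, p + 2 ≤ n' → (modularPolynomialCoeff p m').coeff n' = 0 := fun m' _ h ↦
    coeff_eq_zero_of_natDegree_lt (lt_of_le_of_lt (natDegree_modularPolynomialCoeff_le_succ p m') (by omega))
  have hvan' : ∀ {m' : ℕ}, p + 2 ≤ m' → modularPolynomialCoeff p m' = 0 := fun h ↦
    modularPolynomialCoeff_of_lt (by omega)
  by_cases hm : p + 2 ≤ m
  · rw [hvan n hm, hvan' hm]; simp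
  by_cases hn : p + 2 ≤ n
  · rw [hvan' hn, hvan m hn]; simp
  rw [not_le] at hm hn
  set a : ℕ → ℕ → ℂ := fun m' n' ↦ (modularPolynomialCoeff p n').coeff m' -
    κ₀ * (modularPolynomialCoeff p m').coeff n' with ha
  have hxy : ∀ x y : ℂ, ∑ n' ∈ Finset.range (p + 2),
      (∑ m' ∈ Finset.range (p + 2), a m' n' * x ^ m') * y ^ n' = 0 := by
    intro x y
    have h := eval_swap_eq_mul (p := p) x y
    rw [eval_eq_sum y x, eval_eq_sum_swap x y, Finset.mul_sum, ← sub_eq_zero, ← Finset.sum_sub_distrib] at h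
    rw [← h]
    refine Finset.sum_congr rfl fun n' _ ↦ ?_
    simp only [ha]
    rw [Finset.sum_mul, Finset.sum_mul, Finset.sum_mul, Finset.mul_sum, ← Finset.sum_sub_distrib]
    exact Finset.sum_congr rfl fun m' _ ↦ by ring
  have hx : ∀ x : ℂ, ∀ n' < p + 2, ∑ m' ∈ Finset.range (p + 2), a m' n' * x ^ m' = 0 := fun x ↦
    coeff_eq_zero_of_forall_sum_eq_zero (fun n' ↦ ∑ m' ∈ Finset.range (p + 2), a m' n' * x ^ m')
      (fun y ↦ hxy x y)
  have hmn : a m n = 0 := coeff_eq_zero_of_forall_sum_eq_zero (fun m' ↦ a m' n) (fun x ↦ hx x n hn) m hm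
  simp only [ha] at hmn
  linear_combination hmn

end ModularPolynomialSymm

open ModularPolynomialSymm

variable (p) in
/-- **`deg_Y Φ_p = p + 1` exactly**: the `Y^{p+1}`-coefficient `κ₀` of `P₀(Y)` (the constant term of `Φ_p` in
`X`) is `1` — from `κ_{p,p} = κ₀ κ_{p,p}` and `κ_{p,p} = −1`; the term `Y^{p+1}` of Cox (13.15).
[cite: Cox2013, §11.C Thm. 11.18(iii) and §13.B (13.15)] -/
theorem coeff_modularPolynomialCoeff_zero_succ : (modularPolynomialCoeff p 0).coeff (p + 1) = 1 := by
  have h := coeff_coeff_swap_eq_mul (p := p) p p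
  rw [coeff_modularPolynomialCoeff_self p] at h
  linear_combination h

variable (p) in
/-- **Symmetry of the modular equation of prime level, coefficientwise over `ℂ`**: `κ_{m,n} = κ_{n,m}`.
[cite: Cox2013, §11.C Thm. 11.18(iii); Lang1987, Ch. 5 §2 Thm. 3(ii)] -/
theorem modularPolynomialCoeff_coeff_symm (m n : ℕ) :
    (modularPolynomialCoeff p m).coeff n = (modularPolynomialCoeff p n).coeff m := by
  have h := coeff_coeff_swap_eq_mul (p := p) m n
  rw [coeff_modularPolynomialCoeff_zero_succ, one_mul] at h
  exact h.symm

variable (p) in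
/-- **Symmetry of the modular equation of prime level, in `ℤ[X, Y]`**: for every prime `p` and all `m, n`,
`((intModularPolynomial p).coeff m).coeff n = ((intModularPolynomial p).coeff n).coeff m`, i.e.
`Φ_p(X, Y) = Φ_p(Y, X)`. [cite: Cox2013, §11.C Thm. 11.18(iii); Lang1987, Ch. 5 §2 Thm. 3(ii)] -/
theorem intModularPolynomial_coeff_symm (m n : ℕ) :
    ((intModularPolynomial p).coeff m).coeff n = ((intModularPolynomial p).coeff n).coeff m := by
  have h := modularPolynomialCoeff_coeff_symm p m n
  rw [← map_coeff_intModularPolynomial p m, ← map_coeff_intModularPolynomial p n, coeff_map, coeff_map,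
    eq_intCast, eq_intCast] at h
  exact_mod_cast h

variable (p) in
/-- **Symmetry, pointwise over `ℂ`**: `Φ_p(x, y) = Φ_p(y, x)`. [cite: Cox2013, §11.C Thm. 11.18(iii); Lang1987, Ch. 5 §2 Thm. 3(ii)] -/
theorem modularPolynomial_eval_symm (x y : ℂ) :
    ((modularPolynomial p).map (evalRingHom y)).eval x = ((modularPolynomial p).map (evalRingHom x)).eval y := by
  have h := eval_swap_eq_mul (p := p) x y
  rw [coeff_modularPolynomialCoeff_zero_succ, one_mul] at h
  exact h.symm

variable (p) in
/-- **Symmetry, pointwise, for the integer model**: `Φ_p(x, y) = Φ_p(y, x)` (`x, y ∈ ℂ`), in the shape of the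
level-3 theorem `intModularPolynomial_three_eval_symm`. [cite: Cox2013, §11.C Thm. 11.18(iii); Lang1987, Ch. 5 §2 Thm. 3(ii)] -/
theorem intModularPolynomial_eval_symm (x y : ℂ) :
    (((intModularPolynomial p).map (mapRingHom (Int.castRingHom ℂ))).map (evalRingHom y)).eval x =
      (((intModularPolynomial p).map (mapRingHom (Int.castRingHom ℂ))).map (evalRingHom x)).eval y := by
  rw [map_intModularPolynomial]
  exact modularPolynomial_eval_symm p x y

variable (p) in
/-- `deg P₀ = p + 1` (`deg_Y Φ_p = p + 1`). [cite: Cox2013, §11.C Thm. 11.18(iii) and §13.B (13.15)] -/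
theorem natDegree_modularPolynomialCoeff_zero : (modularPolynomialCoeff p 0).natDegree = p + 1 :=
  le_antisymm (natDegree_modularPolynomialCoeff_le_succ p 0)
    (le_natDegree_of_ne_zero (by rw [coeff_modularPolynomialCoeff_zero_succ]; exact one_ne_zero))

variable (p) in
/-- The same for the integer model `intModularPolynomial p`. [cite: Cox2013, §11.C Thm. 11.18(iii) and §13.B (13.15)] -/
theorem coeff_zero_coeff_succ_intModularPolynomial : ((intModularPolynomial p).coeff 0).coeff (p + 1) = 1 := by
  have h := coeff_modularPolynomialCoeff_zero_succ p
  rw [← map_coeff_intModularPolynomial p 0, coeff_map, eq_intCast] at h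
  exact_mod_cast h

end Literature.NumberTheory.EllipticCurves

end
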